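import Literature.MathematicalPhysics.QuantumFieldTheory.Balaban1983to89.B4Thm112BoxIdentity
import Literature.MathematicalPhysics.QuantumFieldTheory.Balaban1983to89.B4Thm110BoxDerivUniform
import Literature.MathematicalPhysics.QuantumFieldTheory.Balaban1983to89.B4Delta112ZeroBox

/-!
# `Balaban1983to89.B4Thm112BoxValue` — [Balaban1983RegularityDecay] THEOREM p. 573, the `δG` clause (1.11)–(1.12),
# VALUE MEMBER, ON EVERY NESTED PAIR OF BOXES `Ω ⊂ Ω₀`, FOR A (1.7)-REGULAR FIELD, WITH ONLY «e SUFFICIENTLY SMALL»: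
# `|(δG_k(Ω,Ω₀,A)f)(x)| ≤ c₀·exp(−(2K)⁻¹(dist(x,supp f) + dist(x,Ω₀∖Ω) + dist(supp f,Ω₀∖Ω)))·‖f‖_∞` for EVERY `x ∈ Ω`

statement-level skeleton of published theorems with citation tags; proofs where landed; nothing here is a claim about the Yang–Mills mass gap

CITATION HEADER.  T. Bałaban, *Regularity and decay of lattice Green's functions*, Commun. Math. Phys. **89** (1983)
571–597, doi:10.1007/bf01214744 [Balaban1983RegularityDecay] (cell paper B4; held text
`paper:balaban1983-cmp89-regularity-decay`, journal page = PDF page + 570; p. 573 Theorem (1.10)–(1.12), p. 579).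
Unit `lit-balaban-p17` gen 5 (Phase-2 proof seat p17; HOME `run/shared/lean/pub/lit-balaban/`), SKELETON row
**B4.Thm@573** (clause (1.11)–(1.12), value member, rectangular `Ω ⊂ Ω₀`).  Imports p17 g5 `B4Thm112BoxIdentity`
(`extV`, `Layer`, `deltaG_decomp`, `kOp_apply_eq_zero_of_const_near`), p17 g5 `B4Thm110BoxDerivUniform` (→
`B4Thm110BoxUniform`: the uniform value and derivative members of (1.10) on a box, `thm110_value_box_uniform`,
`thm110_deriv_box_uniform`) and the tree's zero-field leaf `B4Delta112ZeroBox` (pv17: the lattice cutoff `chi` with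
its sizes `abs_chi_sub_nbr_le`, `abs_lap_chi_le`, its support `chi_eq_zero_of_extNbrs`, `exists_near_of_chi_ne_one`
— pure lattice geometry, independent of the field).

WHAT IS PRINTED (p. 573).  «If Ω ⊂ Ω₀, then for δG_k(Ω, Ω₀, A) defined by the equality δG_k(Ω,Ω₀,A) = G_k(Ω,A) −
G_k(Ω₀,A), (1.11) we have the inequalities (1.9) and (1.10) (with the same restrictions on x, x′) with the additional
factor exp(−δ₀ dist(supp f, Ω^c) − δ₀ dist(supp f, Ω^c)) (1.12) on the right hand sides. For some simple sets Ω,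
e.g. for rectangular parallelepipeds, the inequalities hold without any restrictions on the points x, x′»; p. 579:
«… with the restriction n ≥ M^{−1} sup_{x₁∈Ω^c}(dist({x,x′},x₁) + dist(x₁, supp f)) − 3 ≥ (2M)^{−1}(dist({x,x′}, supp f)
+ dist({x,x′},Ω^c) + dist(supp f, Ω^c)) − 3».  (The factor (1.12) is read, as in the cell's typed leaf
`B4.Ineq111_112` and in `B4Delta112ZeroBox`, with one distance for the point and one for the source.)

WHAT THIS MODULE PROVES (all in full).  Data: `L = ℓ+1 ≥ 2`, `k ≥ 1`, `n = L^k`, `d ≥ 1`; the windows `a ∈ [a₋,a₊]`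
(`a₋ > 0`), `m² ∈ [0, m²₊]`; the regularity constants `(c, β)`, `β > 0`; the outer box `Ω₀ = Π_μ[0, nMb_μ)` and the
inner box `Ω = n·o + Π_μ[0, nMs_μ)` (`o + Ms ≤ Mb`; unit sides multiples of `K`); a component field `A_c` on `ℤ^{d+1}`,
(1.7)-regular on `Ω₀` (`|A_c(x+e_μ) − A_c(x)| ≤ c·e^{β−1}·η`) and CONSTANT ON THE `K`-COLLARS of `Ω₀` and of `Ω`
(the lineage's reading of «Ã_j = A» at the boundary cubes, HOME/GAPS.md G-B4-p17-02); coupling `e/n`; `0 < e ≤ e₁`.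
* §1 bridges to the zero-field leaf's lattice cutoff: `fits_of_ho`, `subEmb_eq_emb`, `inSub_iff_mem`,
  `extNbrs_nonempty_of_layer`, `chi_eq_zero_of_layer`, `exists_out_of_chi_ne_one`, `hsize_chi` (the sizes
  `|χ| ≤ 1`, `n|∂χ| ≤ 8`, `|n²Δ^Nχ| ≤ 64(d+1)`, `osc ≤ 2` as a `B4Eq220CommutatorZeroBox.HSize`).
* §2 lattice distances versus the lineage's positions (`posR`): `exists_coord_of_le_supNorm`, `le_supNorm_of_coord`,
  `supNorm_subEmb_sub_subEmb`; `abs_apply_le_siteNorm'`, `siteNorm_le_sqrt_card_mul`;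
  **`kOp_chi_apply_le`** — the commutator source `K_χu` at a site is bounded by `√N(16(d+1)B₁ + (64(d+1) + 2a₊)B₀)`
  when `|u| ≤ B₀` and `|D^η_{A,μ}u| ≤ B₁` within one unit of the site (`B4Eq220CommutatorField.siteNorm_kOp_le`).
* §3 **`thm112_value_box_uniform`** — THE VALUE MEMBER OF (1.10)·(1.12) FOR `δG_k(Ω,Ω₀,A)`, HYPOTHESIS-FREE, UNIFORM IN
  THE PAIR OF BOXES: `∃ K (16 ≤ K, 4 ∣ K) ∃ c₀ > 0 ∀ (c,β) ∃ e₁ > 0` such that for every scale, every pair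
  `Ω ⊂ Ω₀` as above, every such `A_c`, `0 < e ≤ e₁`, every site `x ∈ Ω`, every source `f` on `Ω` with `|f| ≤ φ`
  supported in a set `P`, and all reals `D, D_b, D_f ≥ 0` below, respectively, the unit-lattice sup-distances from `x` to
  `P`, from `x` to `Ω₀∖Ω` and from `P` to `Ω₀∖Ω`:
  `|(G_k(Ω,A|Ω)f)(x)_i − (G_k(Ω₀,A)Ef)(x)_i| ≤ c₀·exp(−(D + D_b + D_f)/(2K))·φ`.
  Mechanism: `deltaG_decomp` with pv17's cutoff; the three terms are fed by `thm110_value_box_uniform` on `Ω` (the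
  term `(1−χ)u`, non-zero only within one unit of `Ω₀∖Ω`), on `Ω₀` (the term `G₀E((1−χ)f)`), and — for
  `G₀E(K_χu)` — by the unit-annulus decomposition of the source around `x`, the row form of (1.10) on `Ω₀` per
  annulus, the pointwise bound `kOp_chi_apply_le` fed by the value and derivative members on `Ω`, the support of
  `K_χu` within two units of `Ω₀∖Ω` (`kOp_apply_eq_zero_of_const_near`), and the print's bookkeeping
  `(D + D_b + D_f)/2 − 3` (geometric series in the annulus index).
HONEST SCOPE.  (i) ROUTE: not the print's cancellation of interior-cube walk terms but the cutoff–commutator identity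
(see `B4Thm112BoxIdentity`), fed by the printed members of (1.10) as proved in this lineage.  (ii) `Ω`, `Ω₀` boxes with
unit sides multiples of `K` (print: unions of big blocks; no restriction on `x` for parallelepipeds — none here);
`A` constant on the `K`-collars of BOTH boxes (G-B4-p17-02); `d ≥ 1`; the lineage's (1.6) (running coefficient
`a_kη^{d+1}`, staircase contours).  (iii) Distances are unit-lattice sup-distances (`|·|_∞/n`), to `Ω₀∖Ω ⊆ Ω^c` (so the
printed `dist(·,Ω^c)` is an admissible value); the rate is `(2K)⁻¹` with the file's `K`, the constant `c₀` depends on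
`d, ℓ, N`, the flow and the windows only.  (iv) Value member only (derivative and Hölder members of the `δG` clause:
sequels).  No `sorry`; no new `Prop` fact; axioms standard.
-/

namespace Literature.MathematicalPhysics.QuantumFieldTheory.Balaban1983to89.B4Thm112BoxValue

open Literature.MathematicalPhysics.QuantumFieldTheory.Balaban1983to89.B4Reflection242 (boxDom mem_boxDom nbrs mem_nbrs
  nbrs_comm blk)
open Literature.MathematicalPhysics.QuantumFieldTheory.Balaban1983to89.B4GaugeCovariance
open Literature.MathematicalPhysics.QuantumFieldTheory.Balaban1983to89.B4Commutators25to211 (mulH opK)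
open Literature.MathematicalPhysics.QuantumFieldTheory.Balaban1983to89.B4ContourShift (supNorm supNorm_nonneg
  exists_supNorm_eq abs_le_supNorm)
open Literature.MathematicalPhysics.QuantumFieldTheory.Balaban1983to89.B4Lower18 (supNorm_sub_le_one_of_mem_nbrs)
open Literature.MathematicalPhysics.QuantumFieldTheory.Balaban1983to89.B4Lower18Regular (e1 baseEmb stairContour
  blkWt_ne_zero)
open Literature.MathematicalPhysics.QuantumFieldTheory.Balaban1983to89.B4Lower18RegularRegion (compField)
open Literature.MathematicalPhysics.QuantumFieldTheory.Balaban1983to89.B4Lemma21Region (siteNorm covDeriv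
  fld_covDeriv_mulVec_of_not_mem)
open Literature.MathematicalPhysics.QuantumFieldTheory.Balaban1983to89.B4Lemma22ReduceZero (Box opA greenA derivA)
open Literature.MathematicalPhysics.QuantumFieldTheory.Balaban1983to89.B4Lemma22Reduce231 (siteNorm_nonneg)
open Literature.MathematicalPhysics.QuantumFieldTheory.Balaban1983to89.B4Eq220CommutatorZeroBox (HSize)
open Literature.MathematicalPhysics.QuantumFieldTheory.Balaban1983to89.B4Eq220CommutatorField (kOp siteNorm_kOp_le)
open Literature.MathematicalPhysics.QuantumFieldTheory.Balaban1983to89.B4CubeFieldHyps22 (aSeq_window)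
open Literature.MathematicalPhysics.QuantumFieldTheory.Balaban1983to89.B4Ineq110WalkRoute (mulH_mulVec_apply)
open Literature.MathematicalPhysics.QuantumFieldTheory.Balaban1983to89.B4Green242Bridge (boxNbrs boxBlk)
open Literature.MathematicalPhysics.QuantumFieldTheory.Balaban1983to89.B4TwoBox120 (Fits emb emb_val extNbrs mem_extNbrs)
open Literature.MathematicalPhysics.QuantumFieldTheory.Balaban1983to89.B4Delta112ZeroBox (chi abs_chi_le_one
  abs_chi_sub_nbr_le abs_lap_chi_le exists_near_of_chi_ne_one chi_eq_zero_of_extNbrs supNorm_sub_le_of_boxBlk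
  card_boxBlk_eq two_le_pow)
open Literature.MathematicalPhysics.QuantumFieldTheory.Balaban1983to89.B4Thm110ZeroBox (supNorm_sub_le_sub_add_sub)
open Literature.MathematicalPhysics.QuantumFieldTheory.Balaban1983to89.B4TwoRegion120 (supNorm_sub_comm)
open Literature.MathematicalPhysics.QuantumFieldTheory.Balaban1983to89.B4SubBoxCarrier (subEmb inSub inSub_iff
  subEmb_injective)
open Literature.MathematicalPhysics.QuantumFieldTheory.Balaban1983to89.B4CubeGreenBox (subField)
open Literature.MathematicalPhysics.QuantumFieldTheory.Balaban1983to89.B4BoxCubeGeometry (posR)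
open Literature.MathematicalPhysics.QuantumFieldTheory.Balaban1983to89.B4RegionCubeCarrier (compField_add)
open Literature.MathematicalPhysics.QuantumFieldTheory.Balaban1983to89.B4Thm110BoxUniform (thm110_value_box_uniform)
open Literature.MathematicalPhysics.QuantumFieldTheory.Balaban1983to89.B4Thm110BoxDerivUniform (thm110_deriv_box_uniform)
open Literature.MathematicalPhysics.QuantumFieldTheory.Balaban1983to89.B4Thm112BoxIdentity (extV extV_subEmb
  extV_of_not_inSub Layer deltaG_decomp kOp_apply_eq_zero_of_const_near)
open scoped Matrix

noncomputable section

variable {d : ℕ}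

/-! ## §1. Bridges to the zero-field leaf's lattice cutoff `χ` -/

section Bridges

variable (ℓ k : ℕ) (Mb Ms o : Fin (d + 1) → ℕ)

/-- the lineage's placement `o + Ms ≤ Mb` is the zero-field leaf's `Fits Ms Mb o`.
[cite: Balaban1983RegularityDecay, §1 p.572 «Ω ⊂ Ω₀», dictionary] -/
theorem fits_of_ho (ho : ∀ i, o i + Ms i ≤ Mb i) : Fits Ms Mb (fun i => (o i : ℤ)) := by
  intro i
  refine ⟨?_, ?_⟩
  · show (0 : ℤ) ≤ (o i : ℤ)
    positivity
  · show (o i : ℤ) + (Ms i : ℤ) ≤ (Mb i : ℤ)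
    exact_mod_cast ho i

/-- the lineage's embedding `subEmb` is the zero-field leaf's `emb` (both `z ↦ z + n·o`).
[cite: Balaban1983RegularityDecay, §1 p.572 «Ω ⊂ Ω₀», dictionary] -/
theorem subEmb_eq_emb (ho : ∀ i, o i + Ms i ≤ Mb i) (z : ↥(Box d ℓ k Ms)) :
    subEmb ℓ k Mb Ms o ho z = emb ((fits_of_ho Mb Ms o ho).scale ((ℓ + 1) ^ k)) z := by
  apply Subtype.ext
  funext i
  simp [subEmb, emb_val]

/-- membership in the image, in the zero-field leaf's form. [cite: Balaban1983RegularityDecay, §1 p.572 «Ω ⊂ Ω₀», dictionary] -/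
theorem inSub_iff_mem (y : ↥(Box d ℓ k Mb)) :
    inSub ℓ k Mb Ms o y ↔
      (y.1 - fun i => ((((ℓ + 1) ^ k : ℕ)) : ℤ) * (o i : ℤ)) ∈ boxDom (fun i => (ℓ + 1) ^ k * Ms i) := by
  rw [mem_boxDom]
  unfold inSub
  simp only [Pi.sub_apply]
  constructor
  · intro h i
    obtain ⟨h1, h2⟩ := h i
    rw [mul_add] at h2
    push_cast at h1 h2 ⊢
    constructor <;> linarith
  · intro h i
    obtain ⟨h1, h2⟩ := h i
    rw [mul_add]
    push_cast at h1 h2 ⊢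
    constructor <;> linarith

/-- a site of the lineage's boundary layer has an outer bond leaving `Ω` in the zero-field leaf's sense.
[cite: Balaban1983RegularityDecay, (1.3) p.572, dictionary] -/
theorem extNbrs_nonempty_of_layer (ho : ∀ i, o i + Ms i ≤ Mb i) (z : ↥(Box d ℓ k Ms))
    (hz : Layer ℓ k Mb Ms o ho z) :
    (extNbrs ((ℓ + 1) ^ k) (fits_of_ho Mb Ms o ho) z).Nonempty := by
  obtain ⟨w, hw, hw'⟩ := hz
  refine ⟨w, (mem_extNbrs _).mpr ⟨?_, ?_⟩⟩
  · rw [← subEmb_eq_emb]; exact hw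
  · rw [← inSub_iff_mem]; exact hw'

/-- **THE CUTOFF VANISHES ON THE BOUNDARY LAYER** (`B4Delta112ZeroBox.chi_eq_zero_of_extNbrs`).
[cite: Balaban1983RegularityDecay, p.579, dictionary] -/
theorem chi_eq_zero_of_layer (ho : ∀ i, o i + Ms i ≤ Mb i) (hn : 1 ≤ (ℓ + 1) ^ k) (z : ↥(Box d ℓ k Ms))
    (hz : Layer ℓ k Mb Ms o ho z) : chi ((ℓ + 1) ^ k) Ms Mb (fun i => (o i : ℤ)) z.1 = 0 :=
  chi_eq_zero_of_extNbrs hn (fits_of_ho Mb Ms o ho) z (extNbrs_nonempty_of_layer ℓ k Mb Ms o ho z hz)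

/-- **WHERE THE CUTOFF IS NOT `1`, A SITE OF `Ω₀ ∖ Ω` IS WITHIN ONE UNIT** (`B4Delta112ZeroBox.exists_near_of_chi_ne_one`).
[cite: Balaban1983RegularityDecay, p.579, dictionary] -/
theorem exists_out_of_chi_ne_one (ho : ∀ i, o i + Ms i ≤ Mb i) (hn : 2 ≤ (ℓ + 1) ^ k) (hMs : ∀ i, 1 ≤ Ms i)
    (z : ↥(Box d ℓ k Ms)) (hz : chi ((ℓ + 1) ^ k) Ms Mb (fun i => (o i : ℤ)) z.1 ≠ 1) :
    ∃ y : ↥(Box d ℓ k Mb), ¬ inSub ℓ k Mb Ms o y ∧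
      supNorm ((subEmb ℓ k Mb Ms o ho z).1 - y.1) ≤ (((ℓ + 1) ^ k : ℕ) : ℝ) := by
  obtain ⟨y, hy, hd⟩ := exists_near_of_chi_ne_one hn (fits_of_ho Mb Ms o ho) hMs z hz
  refine ⟨y, fun h => hy ((inSub_iff_mem ℓ k Mb Ms o y).mp h), ?_⟩
  rw [subEmb_eq_emb]
  exact hd

/-- **THE SIZES OF THE CUTOFF** as a `B4Eq220CommutatorZeroBox.HSize`: `|χ| ≤ 1`, `n|χ(y) − χ(x)| ≤ 8` on box bonds,
`|n²Σ_{y∼x}(χ(y) − χ(x))| ≤ 64(d+1)`, block oscillation `≤ 2`. [cite: Balaban1983RegularityDecay, p.577 «|∂^ηh_j| ≤ O(M⁻¹), |Δ^ηh_j| ≤ O(M⁻²)», dictionary] -/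
theorem hsize_chi (hn : 2 ≤ (ℓ + 1) ^ k) (hMs : ∀ i, 1 ≤ Ms i) :
    HSize ((ℓ + 1) ^ k) Ms (fun z : ↥(Box d ℓ k Ms) => chi ((ℓ + 1) ^ k) Ms Mb (fun i => (o i : ℤ)) z.1)
      8 (64 * ((d : ℝ) + 1)) 2 where
  nonneg₁ := by norm_num
  nonneg₂ := by positivity
  nonneg₃ := by norm_num
  abs_le := fun x => abs_chi_le_one _ _ _ _ x.1
  grad_le := by
    intro x y hy
    have hy' : y.1 ∈ nbrs x.1 := by
      unfold boxNbrs at hy; simpa using hy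
    have h := abs_chi_sub_nbr_le ((ℓ + 1) ^ k) Ms Mb (fun i => (o i : ℤ)) y.2 x.2 (nbrs_comm.mp hy')
    have hn0 : (0 : ℝ) ≤ (((ℓ + 1) ^ k : ℕ) : ℝ) := by positivity
    rw [abs_mul, abs_of_nonneg hn0] at h
    exact h
  lap_le := by
    intro x
    have h := abs_lap_chi_le (M := Ms) (M0 := Mb) (s := fun i => (o i : ℤ)) hn hMs x
    have : ∑ y ∈ boxNbrs (fun j => (ℓ + 1) ^ k * Ms j) x,
        (chi ((ℓ + 1) ^ k) Ms Mb (fun i => (o i : ℤ)) y.1 - chi ((ℓ + 1) ^ k) Ms Mb (fun i => (o i : ℤ)) x.1)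
        = -∑ y ∈ boxNbrs (fun j => (ℓ + 1) ^ k * Ms j) x,
          (chi ((ℓ + 1) ^ k) Ms Mb (fun i => (o i : ℤ)) x.1 - chi ((ℓ + 1) ^ k) Ms Mb (fun i => (o i : ℤ)) y.1) := by
      rw [← Finset.sum_neg_distrib]
      refine Finset.sum_congr rfl fun y _ => by ring
    rw [this, mul_neg, abs_neg]
    exact h
  osc_le := by
    intro x y _
    have h1 := abs_chi_le_one ((ℓ + 1) ^ k) Ms Mb (fun i => (o i : ℤ)) x.1
    have h2 := abs_chi_le_one ((ℓ + 1) ^ k) Ms Mb (fun i => (o i : ℤ)) y.1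
    calc |chi ((ℓ + 1) ^ k) Ms Mb (fun i => (o i : ℤ)) x.1 - chi ((ℓ + 1) ^ k) Ms Mb (fun i => (o i : ℤ)) y.1|
        ≤ |chi ((ℓ + 1) ^ k) Ms Mb (fun i => (o i : ℤ)) x.1| + |chi ((ℓ + 1) ^ k) Ms Mb (fun i => (o i : ℤ)) y.1| :=
          abs_sub _ _
      _ ≤ 2 := by linarith

end Bridges

/-! ## §2. Distances, site norms, and the commutator source -/

section Dist

variable (ℓ k : ℕ)

/-- a lower bound for the lattice sup-distance is a lower bound for some coordinate difference of the lineage's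
positions. [cite: Balaban1983RegularityDecay, p.573 «dist(x, supp f)», dictionary] -/
theorem exists_coord_of_le_supNorm (M : Fin (d + 1) → ℕ) (u v : ↥(Box d ℓ k M)) {D : ℝ}
    (h : D * (((ℓ + 1) ^ k : ℕ) : ℝ) ≤ supNorm (u.1 - v.1)) : ∃ μ, D ≤ |posR ℓ k M u μ - posR ℓ k M v μ| := by
  obtain ⟨μ, hμ⟩ := exists_supNorm_eq (u.1 - v.1)
  have hn : (0 : ℝ) < (((ℓ + 1) ^ k : ℕ) : ℝ) := by
    have : 1 ≤ (ℓ + 1) ^ k := Nat.one_le_pow _ _ (Nat.succ_pos ℓ)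
    exact_mod_cast this
  refine ⟨μ, ?_⟩
  rw [posR, posR, ← sub_div, abs_div, abs_of_pos hn, le_div_iff₀ hn]
  rw [hμ, Pi.sub_apply, Int.cast_abs, Int.cast_sub] at h
  exact h

/-- a coordinate difference of the positions is at most the lattice sup-distance.
[cite: Balaban1983RegularityDecay, p.573 «dist(x, supp f)», dictionary] -/
theorem le_supNorm_of_coord (M : Fin (d + 1) → ℕ) (u v : ↥(Box d ℓ k M)) {D : ℝ} {μ : Fin (d + 1)}
    (h : D ≤ |posR ℓ k M u μ - posR ℓ k M v μ|) : D * (((ℓ + 1) ^ k : ℕ) : ℝ) ≤ supNorm (u.1 - v.1) := by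
  have hn : (0 : ℝ) < (((ℓ + 1) ^ k : ℕ) : ℝ) := by
    have : 1 ≤ (ℓ + 1) ^ k := Nat.one_le_pow _ _ (Nat.succ_pos ℓ)
    exact_mod_cast this
  rw [posR, posR, ← sub_div, abs_div, abs_of_pos hn, le_div_iff₀ hn] at h
  refine h.trans ?_
  have := abs_le_supNorm (u.1 - v.1) μ
  rw [Pi.sub_apply, Int.cast_abs, Int.cast_sub] at this
  exact this

/-- translated sites have the same differences. [cite: Balaban1983RegularityDecay, §1 p.572 «Ω ⊂ Ω₀», dictionary] -/
theorem supNorm_subEmb_sub_subEmb (Mb Ms o : Fin (d + 1) → ℕ) (ho : ∀ i, o i + Ms i ≤ Mb i)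
    (a b : ↥(Box d ℓ k Ms)) :
    supNorm ((subEmb ℓ k Mb Ms o ho a).1 - (subEmb ℓ k Mb Ms o ho b).1) = supNorm (a.1 - b.1) := by
  congr 1
  funext i
  simp [subEmb]

/-- a component is at most the site norm (`|·|` of (1.9)–(1.10) is the norm in `R^N`). [cite: Balaban1983RegularityDecay, (1.9)–(1.10) p.573, dictionary] -/
theorem abs_apply_le_siteNorm' {ι : Type} [Fintype ι] (v : ι → ℝ) (i : ι) : |v i| ≤ siteNorm v := by
  unfold siteNorm
  rw [← Real.sqrt_sq_eq_abs]
  refine Real.sqrt_le_sqrt ?_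
  rw [dotProduct, pow_two]
  exact Finset.single_le_sum (f := fun j => v j * v j) (fun j _ => mul_self_nonneg (v j)) (Finset.mem_univ i)

/-- componentwise bounds give `‖v‖ ≤ √N·B` (`|·|` of (1.9)–(1.10) is the norm in `R^N`). [cite: Balaban1983RegularityDecay, (1.9)–(1.10) p.573, dictionary] -/
theorem siteNorm_le_sqrt_card_mul {ι : Type} [Fintype ι] (v : ι → ℝ) {B : ℝ} (hB : 0 ≤ B) (hv : ∀ i, |v i| ≤ B) :
    siteNorm v ≤ Real.sqrt (Fintype.card ι) * B := by
  unfold siteNorm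
  rw [show Real.sqrt (Fintype.card ι) * B = Real.sqrt ((Fintype.card ι : ℝ) * B ^ 2) by
    rw [Real.sqrt_mul (Nat.cast_nonneg _), Real.sqrt_sq hB]]
  refine Real.sqrt_le_sqrt ?_
  calc v ⬝ᵥ v = ∑ i, v i * v i := rfl
    _ ≤ ∑ _i : ι, B ^ 2 := Finset.sum_le_sum fun i _ => by
        have := hv i
        rw [pow_two, ← abs_mul_abs_self]
        exact mul_le_mul this this (abs_nonneg _) hB
    _ = (Fintype.card ι : ℝ) * B ^ 2 := by rw [Finset.sum_const, nsmul_eq_mul, Finset.card_univ]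

end Dist

section Source

variable (ℓ k : ℕ) (Mb Ms o : Fin (d + 1) → ℕ) {ι : Type} [Fintype ι] [DecidableEq ι] (F : OrthFlow ι) (κ : ℝ)

/-- the sup-distance between two sites of a box is less than `n·Σ_i Ms_i` (the walk lengths of p. 579 are bounded on a box). [cite: Balaban1983RegularityDecay, p.579, dictionary] -/
theorem supNorm_sub_lt_box (x a : ↥(Box d ℓ k Ms)) :
    supNorm (x.1 - a.1) < (((ℓ + 1) ^ k : ℕ) : ℝ) * ((∑ i, Ms i : ℕ) : ℝ) + 1 := by
  obtain ⟨μ, hμ⟩ := exists_supNorm_eq (x.1 - a.1)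
  obtain ⟨hx1, hx2⟩ := (mem_boxDom.1 x.2) μ
  obtain ⟨ha1, ha2⟩ := (mem_boxDom.1 a.2) μ
  have hMs : ((Ms μ : ℕ) : ℝ) ≤ ((∑ i, Ms i : ℕ) : ℝ) := by
    exact_mod_cast Finset.single_le_sum (f := Ms) (fun i _ => Nat.zero_le _) (Finset.mem_univ μ)
  rw [hμ, Pi.sub_apply, Int.cast_abs, Int.cast_sub]
  have hn0 : (0 : ℝ) ≤ (((ℓ + 1) ^ k : ℕ) : ℝ) := by positivity
  have hx1' : (0 : ℝ) ≤ ((x.1 μ : ℤ) : ℝ) := by exact_mod_cast hx1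
  have ha1' : (0 : ℝ) ≤ ((a.1 μ : ℤ) : ℝ) := by exact_mod_cast ha1
  have hx2' : ((x.1 μ : ℤ) : ℝ) < (((ℓ + 1) ^ k : ℕ) : ℝ) * ((Ms μ : ℕ) : ℝ) := by exact_mod_cast hx2
  have ha2' : ((a.1 μ : ℤ) : ℝ) < (((ℓ + 1) ^ k : ℕ) : ℝ) * ((Ms μ : ℕ) : ℝ) := by exact_mod_cast ha2
  have h2 : (((ℓ + 1) ^ k : ℕ) : ℝ) * ((Ms μ : ℕ) : ℝ) ≤ (((ℓ + 1) ^ k : ℕ) : ℝ) * ((∑ i, Ms i : ℕ) : ℝ) :=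
    mul_le_mul_of_nonneg_left hMs hn0
  rw [abs_lt]
  constructor <;> linarith

/-- **WHERE THE COMMUTATOR SOURCE IS NON-ZERO, `Ω₀ ∖ Ω` IS WITHIN TWO UNITS**: if `(K_χu)(z) ≠ 0` then `χ` is not
constant around `z` (`kOp_apply_eq_zero_of_const_near`), so `χ ≠ 1` at `z` or at a lattice/block neighbour of `z`,
and a site of `Ω₀` off `Ω` lies within sup-distance `2n` of `z`. [cite: Balaban1983RegularityDecay, p.579, dictionary] -/
theorem exists_out_of_kOp_ne_zero (ho : ∀ i, o i + Ms i ≤ Mb i) (hn : 1 ≤ (ℓ + 1) ^ k) (hn2 : 2 ≤ (ℓ + 1) ^ k)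
    (hMs : ∀ i, 1 ≤ Ms i) (aK m2 : ℝ) (A : ↥(Box d ℓ k Ms) → ↥(Box d ℓ k Ms) → ℝ)
    (u : ↥(Box d ℓ k Ms) × ι → ℝ) (z : ↥(Box d ℓ k Ms)) (j : ι)
    (h : (kOp F κ ((ℓ + 1) ^ k) aK m2 Ms (baseEmb hn Ms) (stairContour hn Ms) A
      (fun z => chi ((ℓ + 1) ^ k) Ms Mb (fun i => (o i : ℤ)) z.1) *ᵥ u) (z, j) ≠ 0) :
    ∃ y : ↥(Box d ℓ k Mb), ¬ inSub ℓ k Mb Ms o y ∧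
      supNorm ((subEmb ℓ k Mb Ms o ho z).1 - y.1) ≤ 2 * (((ℓ + 1) ^ k : ℕ) : ℝ) := by
  set χv : ↥(Box d ℓ k Ms) → ℝ := fun z => chi ((ℓ + 1) ^ k) Ms Mb (fun i => (o i : ℤ)) z.1 with hχv
  have hn0 : (0 : ℝ) ≤ (((ℓ + 1) ^ k : ℕ) : ℝ) := by positivity
  have hn1 : (1 : ℝ) ≤ (((ℓ + 1) ^ k : ℕ) : ℝ) := by exact_mod_cast hn
  -- `χ` is not constant around `z`
  have hnc : ∃ z' : ↥(Box d ℓ k Ms), supNorm (z.1 - z'.1) ≤ (((ℓ + 1) ^ k : ℕ) : ℝ) ∧ χv z' ≠ χv z := by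
    by_contra hc
    push Not at hc
    refine h (kOp_apply_eq_zero_of_const_near F κ aK m2 Ms (baseEmb hn Ms) (stairContour hn Ms) A χv u z
      (fun z' hz' => hc z' ((supNorm_sub_le_one_of_mem_nbrs hz').trans hn1)) (fun z' hz' => hc z' ?_) j)
    have hmem : z' ∈ boxBlk ((ℓ + 1) ^ k) (fun i => (ℓ + 1) ^ k * Ms i) z := by
      unfold boxBlk; simpa using hz'
    exact supNorm_sub_le_of_boxBlk hn hmem
  obtain ⟨z', hzz', hne⟩ := hnc
  by_cases hz : χv z = 1
  · -- then `χ(z') ≠ 1`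
    have hz'1 : χv z' ≠ 1 := fun h' => hne (by rw [hz, h'])
    obtain ⟨y, hy, hd⟩ := exists_out_of_chi_ne_one ℓ k Mb Ms o ho hn2 hMs z' hz'1
    refine ⟨y, hy, ?_⟩
    have t := supNorm_sub_le_sub_add_sub (subEmb ℓ k Mb Ms o ho z).1 (subEmb ℓ k Mb Ms o ho z').1 y.1
    rw [supNorm_subEmb_sub_subEmb] at t
    linarith
  · obtain ⟨y, hy, hd⟩ := exists_out_of_chi_ne_one ℓ k Mb Ms o ho hn2 hMs z hz
    exact ⟨y, hy, by linarith⟩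

/-- **THE COMMUTATOR SOURCE AT A SITE IS CONTROLLED BY `u` AND `D^η_Au` WITHIN ONE UNIT OF THE SITE**: with the sizes
of `χ` (`hsize_chi`) and `B4Eq220CommutatorField.siteNorm_kOp_le` ((2.10) at a field), if `|u| ≤ B₀` and
`|D^η_{A,μ}u| ≤ B₁` (on the bonds of `Ω`) at every site within sup-distance `n` of `z`, then
`|(K_χu)(z)_j| ≤ √N·(16(d+1)B₁ + (64(d+1) + 2a₊)B₀)`. [cite: Balaban1983RegularityDecay, (2.10) p.576, p.577, p.579] -/
theorem kOp_chi_apply_le (hℓ : 1 ≤ ℓ) (hk : 1 ≤ k) (hn : 1 ≤ (ℓ + 1) ^ k) (hMs : ∀ i, 1 ≤ Ms i)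
    {amin aplus a : ℝ} (ha : 0 < amin) (h1 : amin ≤ a) (h2 : a ≤ aplus) (m2 : ℝ)
    (Ac' : (Fin (d + 1) → ℤ) → Fin (d + 1) → ℝ) (u : ↥(Box d ℓ k Ms) × ι → ℝ) (z : ↥(Box d ℓ k Ms))
    {B₀ B₁ : ℝ} (hB₀ : 0 ≤ B₀) (hB₁ : 0 ≤ B₁)
    (hu : ∀ z' : ↥(Box d ℓ k Ms), supNorm (z.1 - z'.1) ≤ (((ℓ + 1) ^ k : ℕ) : ℝ) → ∀ j, |u (z', j)| ≤ B₀)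
    (hDu : ∀ z' : ↥(Box d ℓ k Ms), supNorm (z.1 - z'.1) ≤ (((ℓ + 1) ^ k : ℕ) : ℝ) → ∀ μ,
      z'.1 + e1 μ ∈ Box d ℓ k Ms → ∀ j,
      |(derivA d F κ ℓ k Ms (fun u v : ↥(Box d ℓ k Ms) => compField Ac' u.1 v.1) μ *ᵥ u) (z', j)| ≤ B₁)
    (j : ι) :
    |(kOp F κ ((ℓ + 1) ^ k) (B1.aSeq a ((ℓ : ℝ) + 1) k) m2 Ms (baseEmb hn Ms) (stairContour hn Ms)
        (fun u v : ↥(Box d ℓ k Ms) => compField Ac' u.1 v.1)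
        (fun z => chi ((ℓ + 1) ^ k) Ms Mb (fun i => (o i : ℤ)) z.1) *ᵥ u) (z, j)|
      ≤ Real.sqrt (Fintype.card ι) * (16 * ((d : ℝ) + 1) * B₁ + (64 * ((d : ℝ) + 1) + 2 * aplus) * B₀) := by
  set n : ℕ := (ℓ + 1) ^ k with hn_def
  set N2 : ℝ := Real.sqrt (Fintype.card ι) with hN2
  have hN2_0 : 0 ≤ N2 := Real.sqrt_nonneg _
  have hn2 : 2 ≤ n := two_le_pow hℓ hk
  have hn0 : (0 : ℝ) ≤ ((n : ℕ) : ℝ) := by positivity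
  have hn1 : (1 : ℝ) ≤ ((n : ℕ) : ℝ) := by exact_mod_cast hn
  have hsz := hsize_chi ℓ k Mb Ms o hn2 hMs
  have hanti : ∀ x y : ↥(Box d ℓ k Ms), compField Ac' y.1 x.1 = -compField Ac' x.1 y.1 :=
    fun x y => B4Lemma21Region.compField_rev Ac' x.1 y.1
  obtain ⟨hak1, hak2⟩ := aSeq_window hℓ hk ha h1 h2
  have hak0 : 0 ≤ B1.aSeq a ((ℓ : ℝ) + 1) k := by linarith
  have key := siteNorm_kOp_le F κ (B1.aSeq a ((ℓ : ℝ) + 1) k) m2 Ms (baseEmb hn Ms) (stairContour hn Ms)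
    (fun u v : ↥(Box d ℓ k Ms) => compField Ac' u.1 v.1) hn hanti hak0 hsz u z
  -- the pieces of the right-hand side
  have hval : ∀ z' : ↥(Box d ℓ k Ms), supNorm (z.1 - z'.1) ≤ ((n : ℕ) : ℝ) → siteNorm (fld u z') ≤ N2 * B₀ :=
    fun z' hz' => siteNorm_le_sqrt_card_mul _ hB₀ fun j => hu z' hz' j
  have hder : ∀ z' : ↥(Box d ℓ k Ms), supNorm (z.1 - z'.1) ≤ ((n : ℕ) : ℝ) → ∀ μ,
      siteNorm (fld (covDeriv n (Box d ℓ k Ms) (fieldLink F κ fun u v : ↥(Box d ℓ k Ms) => compField Ac' u.1 v.1) μ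
        *ᵥ u) z') ≤ N2 * B₁ := by
    intro z' hz' μ
    by_cases hμ : z'.1 + e1 μ ∈ Box d ℓ k Ms
    · exact siteNorm_le_sqrt_card_mul _ hB₁ fun j => hDu z' hz' μ hμ j
    · rw [fld_covDeriv_mulVec_of_not_mem _ _ _ hμ, B4Lemma22Reduce231.siteNorm_zero]
      positivity
  -- the sum over the directions
  have hdirs : ∑ μ : Fin (d + 1),
      (siteNorm (fld (covDeriv n (Box d ℓ k Ms) (fieldLink F κ fun u v : ↥(Box d ℓ k Ms) => compField Ac' u.1 v.1) μ
          *ᵥ u) z)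
        + (if hz : z.1 - e1 μ ∈ Box d ℓ k Ms then
            siteNorm (fld (covDeriv n (Box d ℓ k Ms)
              (fieldLink F κ fun u v : ↥(Box d ℓ k Ms) => compField Ac' u.1 v.1) μ *ᵥ u) ⟨z.1 - e1 μ, hz⟩)
          else 0))
      ≤ ((d : ℝ) + 1) * (2 * (N2 * B₁)) := by
    have hz0 : supNorm (z.1 - z.1) ≤ ((n : ℕ) : ℝ) := by
      rw [sub_self, B4BoxCov237.supNorm_zero']; exact hn0
    calc ∑ μ : Fin (d + 1), (siteNorm (fld (covDeriv n (Box d ℓ k Ms)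
            (fieldLink F κ fun u v : ↥(Box d ℓ k Ms) => compField Ac' u.1 v.1) μ *ᵥ u) z)
          + (if hz : z.1 - e1 μ ∈ Box d ℓ k Ms then
              siteNorm (fld (covDeriv n (Box d ℓ k Ms)
                (fieldLink F κ fun u v : ↥(Box d ℓ k Ms) => compField Ac' u.1 v.1) μ *ᵥ u) ⟨z.1 - e1 μ, hz⟩)
            else 0))
        ≤ ∑ _μ : Fin (d + 1), 2 * (N2 * B₁) := by
          refine Finset.sum_le_sum fun μ _ => ?_
          have hA := hder z hz0 μ
          have hB : (if hz : z.1 - e1 μ ∈ Box d ℓ k Ms then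
              siteNorm (fld (covDeriv n (Box d ℓ k Ms)
                (fieldLink F κ fun u v : ↥(Box d ℓ k Ms) => compField Ac' u.1 v.1) μ *ᵥ u) ⟨z.1 - e1 μ, hz⟩)
              else 0) ≤ N2 * B₁ := by
            split_ifs with hz
            · refine hder ⟨z.1 - e1 μ, hz⟩ ?_ μ
              refine (supNorm_sub_le_one_of_mem_nbrs ?_).trans hn1
              exact mem_nbrs.2 ⟨μ, Or.inr rfl⟩
            · positivity
          linarith
      _ = ((d : ℝ) + 1) * (2 * (N2 * B₁)) := by
          rw [Finset.sum_const, Finset.card_univ, Fintype.card_fin, nsmul_eq_mul]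
          push_cast; ring
  -- the block mean
  have hblk : (((n : ℕ) : ℝ) ^ (d + 1))⁻¹ * ∑ z' ∈ boxBlk n (fun i => n * Ms i) z, siteNorm (fld u z') ≤ N2 * B₀ := by
    have hcard := card_boxBlk_eq (M := Ms) hn z
    have hsum : ∑ z' ∈ boxBlk n (fun i => n * Ms i) z, siteNorm (fld u z')
        ≤ ∑ _z' ∈ boxBlk n (fun i => n * Ms i) z, N2 * B₀ :=
      Finset.sum_le_sum fun z' hz' => hval z' (supNorm_sub_le_of_boxBlk hn hz')
    rw [Finset.sum_const, hcard, nsmul_eq_mul] at hsum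
    have hpow : (0 : ℝ) < ((n : ℕ) : ℝ) ^ (d + 1) := by positivity
    calc (((n : ℕ) : ℝ) ^ (d + 1))⁻¹ * ∑ z' ∈ boxBlk n (fun i => n * Ms i) z, siteNorm (fld u z')
        ≤ (((n : ℕ) : ℝ) ^ (d + 1))⁻¹ * (((n ^ (d + 1) : ℕ) : ℝ) * (N2 * B₀)) :=
          mul_le_mul_of_nonneg_left hsum (inv_nonneg.mpr hpow.le)
      _ = N2 * B₀ := by push_cast; field_simp
  have hv0 := hval z (by rw [sub_self, B4BoxCov237.supNorm_zero']; exact hn0)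
  -- assemble
  have hcomp : |(kOp F κ n (B1.aSeq a ((ℓ : ℝ) + 1) k) m2 Ms (baseEmb hn Ms) (stairContour hn Ms)
        (fun u v : ↥(Box d ℓ k Ms) => compField Ac' u.1 v.1)
        (fun z => chi n Ms Mb (fun i => (o i : ℤ)) z.1) *ᵥ u) (z, j)|
      ≤ siteNorm (fld (kOp F κ n (B1.aSeq a ((ℓ : ℝ) + 1) k) m2 Ms (baseEmb hn Ms) (stairContour hn Ms)
        (fun u v : ↥(Box d ℓ k Ms) => compField Ac' u.1 v.1)
        (fun z => chi n Ms Mb (fun i => (o i : ℤ)) z.1) *ᵥ u) z) :=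
    abs_apply_le_siteNorm' (fld (kOp F κ n (B1.aSeq a ((ℓ : ℝ) + 1) k) m2 Ms (baseEmb hn Ms) (stairContour hn Ms)
        (fun u v : ↥(Box d ℓ k Ms) => compField Ac' u.1 v.1)
        (fun z => chi n Ms Mb (fun i => (o i : ℤ)) z.1) *ᵥ u) z) j
  refine hcomp.trans (key.trans ?_)
  have e1' : (8 : ℝ) * (((d : ℝ) + 1) * (2 * (N2 * B₁))) = N2 * (16 * ((d : ℝ) + 1) * B₁) := by ring
  have hA : (8 : ℝ) * ∑ μ : Fin (d + 1),
      (siteNorm (fld (covDeriv n (Box d ℓ k Ms) (fieldLink F κ fun u v : ↥(Box d ℓ k Ms) => compField Ac' u.1 v.1) μ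
          *ᵥ u) z)
        + (if hz : z.1 - e1 μ ∈ Box d ℓ k Ms then
            siteNorm (fld (covDeriv n (Box d ℓ k Ms)
              (fieldLink F κ fun u v : ↥(Box d ℓ k Ms) => compField Ac' u.1 v.1) μ *ᵥ u) ⟨z.1 - e1 μ, hz⟩)
          else 0)) ≤ N2 * (16 * ((d : ℝ) + 1) * B₁) := by
    rw [← e1']; exact mul_le_mul_of_nonneg_left hdirs (by norm_num)
  have hB : 64 * ((d : ℝ) + 1) * siteNorm (fld u z) ≤ 64 * ((d : ℝ) + 1) * (N2 * B₀) :=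
    mul_le_mul_of_nonneg_left hv0 (by positivity)
  have hC : B1.aSeq a ((ℓ : ℝ) + 1) k * 2 *
      ((((n : ℕ) : ℝ) ^ (d + 1))⁻¹ * ∑ z' ∈ boxBlk n (fun i => n * Ms i) z, siteNorm (fld u z'))
      ≤ aplus * 2 * (N2 * B₀) := by
    have h0 : 0 ≤ (((n : ℕ) : ℝ) ^ (d + 1))⁻¹ * ∑ z' ∈ boxBlk n (fun i => n * Ms i) z, siteNorm (fld u z') :=
      mul_nonneg (inv_nonneg.mpr (by positivity)) (Finset.sum_nonneg fun _ _ => siteNorm_nonneg _)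
    calc B1.aSeq a ((ℓ : ℝ) + 1) k * 2 *
          ((((n : ℕ) : ℝ) ^ (d + 1))⁻¹ * ∑ z' ∈ boxBlk n (fun i => n * Ms i) z, siteNorm (fld u z'))
        ≤ aplus * 2 * ((((n : ℕ) : ℝ) ^ (d + 1))⁻¹ * ∑ z' ∈ boxBlk n (fun i => n * Ms i) z, siteNorm (fld u z')) :=
          mul_le_mul_of_nonneg_right (by linarith) h0
      _ ≤ aplus * 2 * (N2 * B₀) := mul_le_mul_of_nonneg_left hblk (by linarith)
  have htot : N2 * (16 * ((d : ℝ) + 1) * B₁) + 64 * ((d : ℝ) + 1) * (N2 * B₀) + aplus * 2 * (N2 * B₀)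
      = N2 * (16 * ((d : ℝ) + 1) * B₁ + (64 * ((d : ℝ) + 1) + 2 * aplus) * B₀) := by ring
  rw [← htot]
  exact add_le_add (add_le_add hA hB) hC

end Source

/-! ## §3. The value member of (1.10)·(1.12) for `δG_k(Ω,Ω₀,A)` on nested boxes -/

section Main

variable {ι : Type} [Fintype ι] [DecidableEq ι]

/-- averaging two lower bounds and clipping at `0` keeps a lower bound (the bookkeeping «(2M)⁻¹(dist + dist + dist) − 3» of p. 579). [cite: Balaban1983RegularityDecay, p.579, dictionary] -/
theorem max_half_mul_le {p q S n : ℝ} (hn : 0 ≤ n) (hp : p * n ≤ S) (hq : q * n ≤ S) (hS : 0 ≤ S) :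
    max ((p + q) / 2) 0 * n ≤ S := by
  rw [max_mul_of_nonneg _ _ hn, zero_mul]
  refine max_le ?_ hS
  nlinarith

/-- three lower bounds, the last being `0`, combined (the bookkeeping of p. 579). [cite: Balaban1983RegularityDecay, p.579, dictionary] -/
theorem max3_mul_le {p q S n : ℝ} (hn : 0 ≤ n) (hp : p * n ≤ S) (hq : q * n ≤ S) (hS : 0 ≤ S) :
    max (max p q) 0 * n ≤ S := by
  rw [max_mul_of_nonneg _ _ hn, max_mul_of_nonneg _ _ hn, zero_mul]
  exact max_le (max_le hp hq) hS

/-- `e^{−D′/K} ≤ e^{s/K}·e^{−S/(2K)}` once `−D′ ≤ s − S/2` (the bookkeeping «(2M)⁻¹(…) − 3» of p. 579). [cite: Balaban1983RegularityDecay, p.579, dictionary] -/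
theorem exp_bookkeeping {D' s S K : ℝ} (hK : 0 < K) (h : -D' ≤ s - S / 2) :
    Real.exp (-(D' / K)) ≤ Real.exp (s / K) * Real.exp (-(S / (2 * K))) := by
  rw [← Real.exp_add, Real.exp_le_exp]
  rw [show s / K + -(S / (2 * K)) = (s - S / 2) / K by field_simp; ring, show -(D' / K) = (-D') / K by ring]
  exact div_le_div_of_nonneg_right h hK.le

/-- **THEOREM p. 573, THE `δG` CLAUSE (1.11)–(1.12), VALUE MEMBER, ON EVERY NESTED PAIR OF BOXES, WITH ONLY «e
SUFFICIENTLY SMALL»**.  There are `K` (`16 ≤ K`, `4 ∣ K`) and `c₀ > 0` (depending on `d`, `ℓ`, `N`, the flow and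
the windows only) such that for every `(c, β)` (`β > 0`) there is `e₁ > 0` with: for every scale `k ≥ 1`
(`n = (ℓ+1)^k`), `a ∈ [a₋,a₊]`, `m² ∈ [0,m²₊]`, every pair of boxes `Ω = n·o + Π[0,nMs) ⊂ Ω₀ = Π[0,nMb)` with unit sides
multiples of `K`, every component field `A_c`, (1.7)-regular on `Ω₀` and constant on the `K`-collars of `Ω₀` and of `Ω`,
every `0 < e ≤ e₁` (coupling `e/n`), every site `x ∈ Ω`, every source `f` on `Ω` supported in `P` with `|f| ≤ φ`, and
all `D, D_b, D_f ≥ 0` dominated by the unit-lattice sup-distances from `x` to `P`, from `x` to `Ω₀ ∖ Ω`, and from `P` to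
`Ω₀ ∖ Ω`:
`|(G_k(Ω,A|Ω)f)(x)_i − (G_k(Ω₀,A)Ef)(x)_i| ≤ c₀·exp(−(D + D_b + D_f)/(2K))·φ`
— «the inequalities (1.10) … with the additional factor (1.12)», for every `x ∈ Ω` («for rectangular parallelepipeds,
the inequalities hold without any restrictions on the points»).
[cite: Balaban1983RegularityDecay, Theorem (1.10)–(1.12) p.573; p.579] -/
theorem thm112_value_box_uniform (F : OrthFlow ι) {ℓ₁ : ℝ} (hℓ₁ : 0 ≤ ℓ₁)
    (hLip : ∀ t (v : ι → ℝ), ((F.U t - 1) *ᵥ v) ⬝ᵥ ((F.U t - 1) *ᵥ v) ≤ (ℓ₁ * t) ^ 2 * (v ⬝ᵥ v))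
    (d ℓ : ℕ) (hd : 1 ≤ d) (hℓ : 1 ≤ ℓ) (amin aplus m2plus : ℝ) (ha : 0 < amin) :
    ∃ K : ℕ, 16 ≤ K ∧ 4 ∣ K ∧ ∃ c₀ : ℝ, 0 < c₀ ∧ ∀ (creg β : ℝ), 0 ≤ creg → 0 < β →
      ∃ e₁ : ℝ, 0 < e₁ ∧ ∀ (k : ℕ), 1 ≤ k → ∀ (hn : 1 ≤ (ℓ + 1) ^ k) (a m2 : ℝ),
      amin ≤ a → a ≤ aplus → 0 ≤ m2 → m2 ≤ m2plus →
      ∀ (Mb Ms o : Fin (d + 1) → ℕ) (ho : ∀ i, o i + Ms i ≤ Mb i), (∀ i, 1 ≤ Ms i) → (∀ μ, K ∣ Mb μ) →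
        (∀ μ, K ∣ Ms μ) →
      ∀ (Ac : (Fin (d + 1) → ℤ) → Fin (d + 1) → ℝ) (e : ℝ), 0 < e → e ≤ e₁ →
        (∀ x ∈ Box d ℓ k Mb, ∀ μ ν : Fin (d + 1),
          |Ac (x + e1 μ) ν - Ac x ν| ≤ creg * e ^ (β - 1) / ((ℓ + 1) ^ k : ℕ)) →
        (∀ w ∈ Box d ℓ k Mb, (∃ μ, w μ < (((ℓ + 1) ^ k : ℕ) : ℤ) * K ∨
            (((ℓ + 1) ^ k : ℕ) : ℤ) * Mb μ < w μ + (((ℓ + 1) ^ k : ℕ) : ℤ) * K) → ∀ ν, Ac w ν = Ac 0 ν) →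
        (∀ w ∈ Box d ℓ k Ms, (∃ μ, w μ < (((ℓ + 1) ^ k : ℕ) : ℤ) * K ∨
            (((ℓ + 1) ^ k : ℕ) : ℤ) * Ms μ < w μ + (((ℓ + 1) ^ k : ℕ) : ℤ) * K) →
          ∀ ν, Ac (w + fun i => (((ℓ + 1) ^ k : ℕ) : ℤ) * (o i : ℤ)) ν
            = Ac (fun i => (((ℓ + 1) ^ k : ℕ) : ℤ) * (o i : ℤ)) ν) →
      ∀ (x : ↥(Box d ℓ k Ms)) (P : ↥(Box d ℓ k Ms) → Prop) [DecidablePred P] (D Db Df : ℝ),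
        0 ≤ D → 0 ≤ Db → 0 ≤ Df →
        (∀ x', P x' → ∃ μ, D ≤ |posR ℓ k Ms x μ - posR ℓ k Ms x' μ|) →
        (∀ y : ↥(Box d ℓ k Mb), ¬ inSub ℓ k Mb Ms o y →
          ∃ μ, Db ≤ |posR ℓ k Mb (subEmb ℓ k Mb Ms o ho x) μ - posR ℓ k Mb y μ|) →
        (∀ x', P x' → ∀ y : ↥(Box d ℓ k Mb), ¬ inSub ℓ k Mb Ms o y →
          ∃ μ, Df ≤ |posR ℓ k Mb (subEmb ℓ k Mb Ms o ho x') μ - posR ℓ k Mb y μ|) →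
      ∀ (f : ↥(Box d ℓ k Ms) × ι → ℝ), (∀ p, ¬ P p.1 → f p = 0) → ∀ (φ : ℝ), 0 ≤ φ → (∀ p, |f p| ≤ φ) →
      ∀ i : ι,
        |(greenA d F (e / ((ℓ + 1) ^ k : ℕ)) ℓ k a m2 Ms (baseEmb hn Ms) (stairContour hn Ms)
              (fun u v : ↥(Box d ℓ k Ms) =>
                compField (fun w => Ac (w + fun i => (((ℓ + 1) ^ k : ℕ) : ℤ) * (o i : ℤ))) u.1 v.1) *ᵥ f) (x, i)
          - (greenA d F (e / ((ℓ + 1) ^ k : ℕ)) ℓ k a m2 Mb (baseEmb hn Mb) (stairContour hn Mb)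
              (fun u v : ↥(Box d ℓ k Mb) => compField Ac u.1 v.1) *ᵥ extV ℓ k Mb Ms o f)
              (subEmb ℓ k Mb Ms o ho x, i)|
          ≤ c₀ * Real.exp (-((D + Db + Df) / (2 * K))) * φ := by
  classical
  obtain ⟨Kv, hKv8, h4v, cv, hcv, HV⟩ := thm110_value_box_uniform F hℓ₁ hLip d ℓ hd hℓ amin aplus m2plus ha
  obtain ⟨Kd, hKd8, -, cd, hcd, HD⟩ := thm110_deriv_box_uniform F hℓ₁ hLip d ℓ hd hℓ amin aplus m2plus ha
  set K : ℕ := Kv * Kd with hK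
  have hKvK : Kv ≤ K := by rw [hK]; nlinarith
  have hKdK : Kd ≤ K := by rw [hK]; nlinarith
  have hK16 : 16 ≤ K := by rw [hK]; nlinarith
  have h4 : 4 ∣ K := dvd_mul_of_dvd_left h4v Kd
  have hKvr : (0 : ℝ) < Kv := by exact_mod_cast lt_of_lt_of_le (by norm_num) hKv8
  have hKdr : (0 : ℝ) < Kd := by exact_mod_cast lt_of_lt_of_le (by norm_num) hKd8
  have hKr : (0 : ℝ) < K := by exact_mod_cast lt_of_lt_of_le (by norm_num) hK16
  have hKvKr : (Kv : ℝ) ≤ K := by exact_mod_cast hKvK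
  have hKdKr : (Kd : ℝ) ≤ K := by exact_mod_cast hKdK
  have hmonoV : ∀ {D' : ℝ}, 0 ≤ D' → Real.exp (-(D' / Kv)) ≤ Real.exp (-(D' / K)) := fun hD' =>
    Real.exp_le_exp.mpr (neg_le_neg (div_le_div_of_nonneg_left hD' hKvr hKvKr))
  have hmonoD : ∀ {D' : ℝ}, 0 ≤ D' → Real.exp (-(D' / Kd)) ≤ Real.exp (-(D' / K)) := fun hD' =>
    Real.exp_le_exp.mpr (neg_le_neg (div_le_div_of_nonneg_left hD' hKdr hKdKr))
  -- the constants
  set N2 : ℝ := Real.sqrt (Fintype.card ι) with hN2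
  have hN2_0 : 0 ≤ N2 := Real.sqrt_nonneg _
  set CK : ℝ := N2 * (16 * ((d : ℝ) + 1) * cd + (64 * ((d : ℝ) + 1) + 2 * aplus) * cv) with hCK
  set r : ℝ := Real.exp (-(1 / (2 * K))) with hr
  have hr0 : 0 ≤ r := (Real.exp_pos _).le
  have hr1 : r < 1 := Real.exp_lt_one_iff.mpr (by
    have : 0 < 1 / (2 * (K : ℝ)) := by positivity
    linarith)
  have h1r : 0 < 1 - r := by linarith
  set c₀ : ℝ := 2 * cv * Real.exp (1 / K) + cv * |CK| * Real.exp (4 / K) / (1 - r) + 1 with hc₀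
  have hc₀0 : 0 < c₀ := by positivity
  refine ⟨K, hK16, h4, c₀, hc₀0, fun creg β hcreg hβ => ?_⟩
  obtain ⟨ev, hev, HV'⟩ := HV creg β hcreg hβ
  obtain ⟨ed, hed, HD'⟩ := HD creg β hcreg hβ
  refine ⟨min ev ed, lt_min hev hed, ?_⟩
  intro k hk hn a m2 ha1 ha2 hm1 hm2 Mb Ms o ho hMs hKMb hKMs Ac e he hle h17 hcol0 hcolΩ x P _ D Db Df hD0 hDb0 hDf0
    hD hDb hDf f hfP φ hφ hf i
  -- scale facts
  have hn2 : 2 ≤ (ℓ + 1) ^ k := two_le_pow hℓ hk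
  have hnr : (0 : ℝ) < (((ℓ + 1) ^ k : ℕ) : ℝ) := by exact_mod_cast hn
  have hnr1 : (1 : ℝ) ≤ (((ℓ + 1) ^ k : ℕ) : ℝ) := by exact_mod_cast hn
  have hMb : ∀ i, 1 ≤ Mb i := fun i => le_trans (le_trans (hMs i) (Nat.le_add_left _ _)) (ho i)
  have ha' : 0 < a := lt_of_lt_of_le ha ha1
  have hlev : e ≤ ev := hle.trans (min_le_left _ _)
  have hled : e ≤ ed := hle.trans (min_le_right _ _)
  have hKvMb : ∀ μ, Kv ∣ Mb μ := fun μ => (Dvd.intro Kd rfl).trans (hKMb μ)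
  have hKvMs : ∀ μ, Kv ∣ Ms μ := fun μ => (Dvd.intro Kd rfl).trans (hKMs μ)
  have hKdMs : ∀ μ, Kd ∣ Ms μ := fun μ => (Dvd.intro_left Kv rfl).trans (hKMs μ)
  -- the translated component field of `Ω`
  set t : Fin (d + 1) → ℤ := fun i => (((ℓ + 1) ^ k : ℕ) : ℤ) * (o i : ℤ) with ht
  set Ac' : (Fin (d + 1) → ℤ) → Fin (d + 1) → ℝ := fun w => Ac (w + t) with hAc'
  have hsubF : subField ℓ k Mb Ms o ho (fun u v : ↥(Box d ℓ k Mb) => compField Ac u.1 v.1)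
      = fun u v : ↥(Box d ℓ k Ms) => compField Ac' u.1 v.1 := by
    funext a' b'
    show compField Ac (subEmb ℓ k Mb Ms o ho a').1 (subEmb ℓ k Mb Ms o ho b').1 = compField Ac' a'.1 b'.1
    have h1 : (subEmb ℓ k Mb Ms o ho a').1 = a'.1 + t := by funext j; simp [subEmb, ht]
    have h2 : (subEmb ℓ k Mb Ms o ho b').1 = b'.1 + t := by funext j; simp [subEmb, ht]
    rw [h1, h2, compField_add]
  -- regularity and collars of the translated field; collars of width `Kv`, `Kd`
  have hmemT : ∀ w ∈ Box d ℓ k Ms, w + t ∈ Box d ℓ k Mb := fun w hw =>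
    B4SubBoxCarrier.shift_mem_Box ℓ k Mb Ms o ho ⟨w, hw⟩
  have h17' : ∀ w ∈ Box d ℓ k Ms, ∀ μ ν : Fin (d + 1),
      |Ac' (w + e1 μ) ν - Ac' w ν| ≤ creg * e ^ (β - 1) / ((ℓ + 1) ^ k : ℕ) := by
    intro w hw μ ν
    have := h17 (w + t) (hmemT w hw) μ ν
    simp only [hAc']
    rw [add_right_comm]
    exact this
  have hcolW : ∀ K' : ℕ, K' ≤ K → ∀ (M : Fin (d + 1) → ℕ) (w : Fin (d + 1) → ℤ),
      (∃ μ, w μ < (((ℓ + 1) ^ k : ℕ) : ℤ) * K' ∨ (((ℓ + 1) ^ k : ℕ) : ℤ) * M μ < w μ + (((ℓ + 1) ^ k : ℕ) : ℤ) * K') →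
      (∃ μ, w μ < (((ℓ + 1) ^ k : ℕ) : ℤ) * K ∨ (((ℓ + 1) ^ k : ℕ) : ℤ) * M μ < w μ + (((ℓ + 1) ^ k : ℕ) : ℤ) * K) := by
    intro K' hK' M w hex
    have hKK : (((ℓ + 1) ^ k : ℕ) : ℤ) * K' ≤ (((ℓ + 1) ^ k : ℕ) : ℤ) * K :=
      mul_le_mul_of_nonneg_left (by exact_mod_cast hK') (by positivity)
    obtain ⟨μ, hμ | hμ⟩ := hex
    · exact ⟨μ, Or.inl (lt_of_lt_of_le hμ hKK)⟩
    · exact ⟨μ, Or.inr (by linarith only [hμ, hKK])⟩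
  have hcol0v : ∀ w ∈ Box d ℓ k Mb, (∃ μ, w μ < (((ℓ + 1) ^ k : ℕ) : ℤ) * Kv ∨
      (((ℓ + 1) ^ k : ℕ) : ℤ) * Mb μ < w μ + (((ℓ + 1) ^ k : ℕ) : ℤ) * Kv) → ∀ ν, Ac w ν = Ac 0 ν :=
    fun w hw hex => hcol0 w hw (hcolW Kv hKvK Mb w hex)
  have hcolΩ' : ∀ K' : ℕ, K' ≤ K → ∀ w ∈ Box d ℓ k Ms, (∃ μ, w μ < (((ℓ + 1) ^ k : ℕ) : ℤ) * K' ∨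
      (((ℓ + 1) ^ k : ℕ) : ℤ) * Ms μ < w μ + (((ℓ + 1) ^ k : ℕ) : ℤ) * K') → ∀ ν, Ac' w ν = Ac' 0 ν := by
    intro K' hK' w hw hex ν
    simp only [hAc']
    rw [zero_add]
    exact hcolΩ w hw (hcolW K' hK' Ms w hex) ν
  -- the members of (1.10) on `Ω` and `Ω₀`
  have VΩ := HV' k hk hn a m2 ha1 ha2 hm1 hm2 Ms hMs hKvMs Ac' e he hlev h17' (hcolΩ' Kv hKvK)
  have VΩ₀ := HV' k hk hn a m2 ha1 ha2 hm1 hm2 Mb hMb hKvMb Ac e he hlev h17 hcol0v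
  have DΩ := HD' k hk hn a m2 ha1 ha2 hm1 hm2 Ms hMs hKdMs Ac' e he hled h17' (hcolΩ' Kd hKdK)
  -- the cutoff and the decomposition
  set χv : ↥(Box d ℓ k Ms) → ℝ := fun z => chi ((ℓ + 1) ^ k) Ms Mb (fun i => (o i : ℤ)) z.1 with hχv
  have hχL : ∀ z, Layer ℓ k Mb Ms o ho z → χv z = 0 := fun z hz => chi_eq_zero_of_layer ℓ k Mb Ms o ho hn z hz
  have hχ01 : ∀ z, 0 ≤ χv z ∧ χv z ≤ 1 := fun z =>
    ⟨B4Delta112ZeroBox.chi_nonneg _ _ _ _ _, B4Delta112ZeroBox.chi_le_one _ _ _ _ _⟩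
  have hdec := deltaG_decomp ℓ k Mb Ms o F (e / ((ℓ + 1) ^ k : ℕ)) ho hℓ hk hn ha' hm1
    (fun u v : ↥(Box d ℓ k Mb) => compField Ac u.1 v.1) χv hχL f x i
  rw [hsubF] at hdec
  rw [hdec]
  -- abbreviations
  set GΩ := greenA d F (e / ((ℓ + 1) ^ k : ℕ)) ℓ k a m2 Ms (baseEmb hn Ms) (stairContour hn Ms)
    (fun u v : ↥(Box d ℓ k Ms) => compField Ac' u.1 v.1) with hGΩ
  set G₀ := greenA d F (e / ((ℓ + 1) ^ k : ℕ)) ℓ k a m2 Mb (baseEmb hn Mb) (stairContour hn Mb)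
    (fun u v : ↥(Box d ℓ k Mb) => compField Ac u.1 v.1) with hG₀
  set u := GΩ *ᵥ f with hu
  set g := kOp F (e / ((ℓ + 1) ^ k : ℕ)) ((ℓ + 1) ^ k) (B1.aSeq a ((ℓ : ℝ) + 1) k) m2 Ms (baseEmb hn Ms)
    (stairContour hn Ms) (fun u v : ↥(Box d ℓ k Ms) => compField Ac' u.1 v.1) χv *ᵥ u with hg
  set FF : ℝ := Real.exp (-((D + Db + Df) / (2 * K))) with hFF
  have hFF0 : 0 < FF := Real.exp_pos _
  -- distance tools
  have hDx : ∀ x', P x' → D * (((ℓ + 1) ^ k : ℕ) : ℝ) ≤ supNorm (x.1 - x'.1) := fun x' hx' => by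
    obtain ⟨μ, hμ⟩ := hD x' hx'; exact le_supNorm_of_coord ℓ k Ms x x' hμ
  have hDbx : ∀ y : ↥(Box d ℓ k Mb), ¬ inSub ℓ k Mb Ms o y →
      Db * (((ℓ + 1) ^ k : ℕ) : ℝ) ≤ supNorm ((subEmb ℓ k Mb Ms o ho x).1 - y.1) := fun y hy => by
    obtain ⟨μ, hμ⟩ := hDb y hy; exact le_supNorm_of_coord ℓ k Mb _ y hμ
  have hDfx : ∀ x', P x' → ∀ y : ↥(Box d ℓ k Mb), ¬ inSub ℓ k Mb Ms o y →
      Df * (((ℓ + 1) ^ k : ℕ) : ℝ) ≤ supNorm ((subEmb ℓ k Mb Ms o ho x').1 - y.1) := fun x' hx' y hy => by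
    obtain ⟨μ, hμ⟩ := hDf x' hx' y hy; exact le_supNorm_of_coord ℓ k Mb _ y hμ
  ---------------------------------------------------------------- T1
  have hT1 : |(1 - χv x) * u (x, i)| ≤ cv * Real.exp (1 / K) * FF * φ := by
    by_cases hx1 : χv x = 1
    · rw [hx1, sub_self, zero_mul, abs_zero]; positivity
    obtain ⟨y, hy, hdy⟩ := exists_out_of_chi_ne_one ℓ k Mb Ms o ho hn2 hMs x hx1
    have hDb1 : Db ≤ 1 := by
      have := (hDbx y hy).trans hdy
      exact le_of_mul_le_mul_right (by linarith only [this]) hnr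
    set D₁ : ℝ := max ((D + (Df - 1)) / 2) 0 with hD₁
    have hD₁0 : 0 ≤ D₁ := le_max_right _ _
    have hD₁P : ∀ x', P x' → ∃ μ, D₁ ≤ |posR ℓ k Ms x μ - posR ℓ k Ms x' μ| := by
      intro x' hx'
      refine exists_coord_of_le_supNorm ℓ k Ms x x' (max_half_mul_le hnr.le (hDx x' hx') ?_ (supNorm_nonneg _))
      have t1 := supNorm_sub_le_sub_add_sub (subEmb ℓ k Mb Ms o ho x').1 (subEmb ℓ k Mb Ms o ho x).1 y.1
      rw [supNorm_subEmb_sub_subEmb, supNorm_sub_comm x'.1] at t1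
      have := hDfx x' hx' y hy
      rw [sub_mul, one_mul]
      linarith only [t1, this, hdy]
    have hux := VΩ x P D₁ hD₁P f hfP φ hφ hf i
    have hexp : Real.exp (-(D₁ / Kv)) ≤ Real.exp (1 / K) * FF :=
      (hmonoV hD₁0).trans (exp_bookkeeping hKr (by
        have : (D + (Df - 1)) / 2 ≤ D₁ := le_max_left _ _
        linarith only [this, hDb1]))
    have h1χ : |1 - χv x| ≤ 1 := by
      obtain ⟨h0, h1⟩ := hχ01 x
      rw [abs_of_nonneg (by linarith only [h1])]; linarith only [h0]
    rw [abs_mul]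
    calc |1 - χv x| * |u (x, i)| ≤ 1 * (cv * Real.exp (-(D₁ / Kv)) * φ) :=
          mul_le_mul h1χ hux (abs_nonneg _) zero_le_one
      _ ≤ cv * (Real.exp (1 / K) * FF) * φ := by
          rw [one_mul]; exact mul_le_mul_of_nonneg_right (mul_le_mul_of_nonneg_left hexp hcv.le) hφ
      _ = cv * Real.exp (1 / K) * FF * φ := by ring
  ---------------------------------------------------------------- T3
  have hT3 : |(G₀ *ᵥ extV ℓ k Mb Ms o (mulH (ι := ι) (fun z => 1 - χv z) *ᵥ f)) (subEmb ℓ k Mb Ms o ho x, i)|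
      ≤ cv * Real.exp (1 / K) * FF * φ := by
    set f₃ := mulH (ι := ι) (fun z => 1 - χv z) *ᵥ f with hf₃
    have hf₃v : ∀ q, f₃ q = (1 - χv q.1) * f q := fun q => mulH_mulVec_apply _ _ q
    by_cases hP3 : ∃ a₀, P a₀ ∧ χv a₀ ≠ 1
    · obtain ⟨a₀, ha₀P, ha₀χ⟩ := hP3
      obtain ⟨y₀, hy₀, hd₀⟩ := exists_out_of_chi_ne_one ℓ k Mb Ms o ho hn2 hMs a₀ ha₀χ
      have hDf1 : Df ≤ 1 := by
        have := (hDfx a₀ ha₀P y₀ hy₀).trans hd₀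
        exact le_of_mul_le_mul_right (by linarith only [this]) hnr
      set D₃ : ℝ := max ((D + (Db - 1)) / 2) 0 with hD₃
      have hD₃0 : 0 ≤ D₃ := le_max_right _ _
      set P₃ : ↥(Box d ℓ k Mb) → Prop := fun y => ∃ a', subEmb ℓ k Mb Ms o ho a' = y ∧ P a' ∧ χv a' ≠ 1 with hP₃
      haveI hP₃d : DecidablePred P₃ := Classical.decPred P₃
      have hD₃P : ∀ y, P₃ y → ∃ μ, D₃ ≤ |posR ℓ k Mb (subEmb ℓ k Mb Ms o ho x) μ - posR ℓ k Mb y μ| := by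
        rintro y ⟨a', rfl, ha'P, ha'χ⟩
        obtain ⟨y', hy', hd'⟩ := exists_out_of_chi_ne_one ℓ k Mb Ms o ho hn2 hMs a' ha'χ
        refine exists_coord_of_le_supNorm ℓ k Mb _ _ (max_half_mul_le hnr.le ?_ ?_ (supNorm_nonneg _))
        · rw [supNorm_subEmb_sub_subEmb]; exact hDx a' ha'P
        · have t1 := supNorm_sub_le_sub_add_sub (subEmb ℓ k Mb Ms o ho x).1 (subEmb ℓ k Mb Ms o ho a').1 y'.1
          have := hDbx y' hy'
          rw [sub_mul, one_mul]
          linarith only [t1, this, hd']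
      have hsupp : ∀ q : ↥(Box d ℓ k Mb) × ι, ¬ P₃ q.1 → extV ℓ k Mb Ms o f₃ q = 0 := by
        intro q hq
        by_cases hqi : inSub ℓ k Mb Ms o q.1
        · obtain ⟨a', ha'⟩ := (inSub_iff ℓ k Mb Ms o ho _).mp hqi
          have hq' : q = (subEmb ℓ k Mb Ms o ho a', q.2) := Prod.ext ha'.symm rfl
          rw [hq', extV_subEmb, hf₃v]
          by_cases hPa : P a'
          · have hχa : χv a' = 1 := by
              by_contra hc; exact hq ⟨a', ha', hPa, hc⟩
            simp only [hχa, sub_self, zero_mul]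
          · rw [hfP (a', q.2) hPa, mul_zero]
        · exact extV_of_not_inSub ℓ k Mb Ms o f₃ hqi
      have hbd : ∀ q : ↥(Box d ℓ k Mb) × ι, |extV ℓ k Mb Ms o f₃ q| ≤ φ := by
        intro q
        by_cases hqi : inSub ℓ k Mb Ms o q.1
        · obtain ⟨a', ha'⟩ := (inSub_iff ℓ k Mb Ms o ho _).mp hqi
          have hq' : q = (subEmb ℓ k Mb Ms o ho a', q.2) := Prod.ext ha'.symm rfl
          rw [hq', extV_subEmb, hf₃v, abs_mul]
          obtain ⟨h0, h1⟩ := hχ01 a'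
          calc |1 - χv a'| * |f (a', q.2)| ≤ 1 * φ :=
                mul_le_mul (by rw [abs_of_nonneg (by linarith only [h1])]; linarith only [h0]) (hf _)
                  (abs_nonneg _) zero_le_one
            _ = φ := one_mul φ
        · rw [extV_of_not_inSub ℓ k Mb Ms o f₃ hqi, abs_zero]; exact hφ
      have h3 := VΩ₀ (subEmb ℓ k Mb Ms o ho x) P₃ D₃ hD₃P (extV ℓ k Mb Ms o f₃) hsupp φ hφ hbd i
      have hexp : Real.exp (-(D₃ / Kv)) ≤ Real.exp (1 / K) * FF :=
        (hmonoV hD₃0).trans (exp_bookkeeping hKr (by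
          have : (D + (Db - 1)) / 2 ≤ D₃ := le_max_left _ _
          linarith only [this, hDf1]))
      calc |(G₀ *ᵥ extV ℓ k Mb Ms o f₃) (subEmb ℓ k Mb Ms o ho x, i)| ≤ cv * Real.exp (-(D₃ / Kv)) * φ := h3
        _ ≤ cv * (Real.exp (1 / K) * FF) * φ :=
            mul_le_mul_of_nonneg_right (mul_le_mul_of_nonneg_left hexp hcv.le) hφ
        _ = cv * Real.exp (1 / K) * FF * φ := by ring
    · -- no source point off the plateau of `χ`: the third term vanishes
      push Not at hP3
      have hf₃0 : f₃ = 0 := by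
        funext q
        rw [hf₃v]
        by_cases hPq : P q.1
        · rw [hP3 q.1 hPq, sub_self, zero_mul]; rfl
        · rw [hfP q hPq, mul_zero]; rfl
      have hE0 : extV ℓ k Mb Ms o f₃ = 0 := by
        funext q; rw [hf₃0]; simp [extV]
      rw [hE0, Matrix.mulVec_zero, Pi.zero_apply, abs_zero]
      positivity
  ---------------------------------------------------------------- T2
  have hT2 : |(G₀ *ᵥ extV ℓ k Mb Ms o g) (subEmb ℓ k Mb Ms o ho x, i)|
      ≤ cv * |CK| * Real.exp (4 / K) / (1 - r) * FF * φ := by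
    -- the unit annuli around `x`
    set mI : ↥(Box d ℓ k Ms) → ℕ := fun a' => ⌊supNorm (x.1 - a'.1) / (((ℓ + 1) ^ k : ℕ) : ℝ)⌋₊ with hmI
    set Mtop : ℕ := (∑ i, Ms i) + 1 with hMtop
    have hmI_le : ∀ a', (mI a' : ℝ) * (((ℓ + 1) ^ k : ℕ) : ℝ) ≤ supNorm (x.1 - a'.1) := by
      intro a'
      have := Nat.floor_le (div_nonneg (supNorm_nonneg (x.1 - a'.1)) hnr.le)
      rw [hmI]
      exact (le_div_iff₀ hnr).mp this
    have hmI_gt : ∀ a', supNorm (x.1 - a'.1) < ((mI a' : ℝ) + 1) * (((ℓ + 1) ^ k : ℕ) : ℝ) := by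
      intro a'
      have := Nat.lt_floor_add_one (supNorm (x.1 - a'.1) / (((ℓ + 1) ^ k : ℕ) : ℝ))
      rw [hmI]
      exact (div_lt_iff₀ hnr).mp this
    have hmI_lt : ∀ a', mI a' < Mtop := by
      intro a'
      have h1 := hmI_le a'
      have h2 := supNorm_sub_lt_box ℓ k Ms x a'
      have h3 : (mI a' : ℝ) * (((ℓ + 1) ^ k : ℕ) : ℝ) < (((∑ i, Ms i : ℕ) : ℝ) + 1) * (((ℓ + 1) ^ k : ℕ) : ℝ) := by
        rw [add_mul, one_mul]
        linarith only [h1, h2, hnr1]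
      have h4 : (mI a' : ℝ) < ((∑ i, Ms i : ℕ) : ℝ) + 1 := lt_of_mul_lt_mul_right h3 hnr.le
      rw [hMtop]
      exact_mod_cast h4
    set gm : ℕ → ↥(Box d ℓ k Ms) × ι → ℝ := fun m q => if mI q.1 = m then g q else 0 with hgm
    have hsplit : extV ℓ k Mb Ms o g = ∑ m ∈ Finset.range Mtop, extV ℓ k Mb Ms o (gm m) := by
      funext q
      rw [Finset.sum_apply]
      by_cases hq : inSub ℓ k Mb Ms o q.1
      · simp only [extV, dif_pos hq, hgm]
        rw [Finset.sum_ite_eq, if_pos (Finset.mem_range.mpr (hmI_lt _))]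
      · simp only [extV, dif_neg hq, Finset.sum_const_zero]
    -- the per-annulus sizes
    set Rm : ℕ → ℝ := fun m => max (max (D - m - 2) (Df - 3)) 0 with hRm
    have hRm0 : ∀ m, 0 ≤ Rm m := fun m => le_max_right _ _
    set Φm : ℕ → ℝ := fun m => |CK| * Real.exp (-(Rm m / K)) * φ with hΦm
    have hΦm0 : ∀ m, 0 ≤ Φm m := fun m => by positivity
    -- (i) the source on the annulus `m`: size and support
    have hsrc : ∀ m (q : ↥(Box d ℓ k Mb) × ι),
        |extV ℓ k Mb Ms o (gm m) q| ≤ Φm m ∧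
        (((m : ℝ) + 3 ≤ Db) → extV ℓ k Mb Ms o (gm m) q = 0) ∧
        (extV ℓ k Mb Ms o (gm m) q ≠ 0 → ∃ a', subEmb ℓ k Mb Ms o ho a' = q.1 ∧ mI a' = m) := by
      intro m q
      by_cases hqi : inSub ℓ k Mb Ms o q.1
      swap
      · rw [extV_of_not_inSub ℓ k Mb Ms o _ hqi, abs_zero]
        exact ⟨hΦm0 m, fun _ => rfl, fun h => absurd rfl h⟩
      obtain ⟨a', ha'⟩ := (inSub_iff ℓ k Mb Ms o ho _).mp hqi
      have hq' : q = (subEmb ℓ k Mb Ms o ho a', q.2) := Prod.ext ha'.symm rfl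
      rw [hq', extV_subEmb]
      simp only [hgm]
      by_cases hma : mI a' = m
      swap
      · rw [if_neg hma, abs_zero]
        exact ⟨hΦm0 m, fun _ => rfl, fun h => absurd rfl h⟩
      rw [if_pos hma]
      refine ⟨?_, ?_, fun _ => ⟨a', rfl, hma⟩⟩
      · -- size
        by_cases hg0 : g (a', q.2) = 0
        · rw [hg0, abs_zero]; exact hΦm0 m
        obtain ⟨y, hy, hdy⟩ := exists_out_of_kOp_ne_zero ℓ k Mb Ms o F (e / ((ℓ + 1) ^ k : ℕ)) ho hn hn2 hMs
          (B1.aSeq a ((ℓ : ℝ) + 1) k) m2 (fun u v : ↥(Box d ℓ k Ms) => compField Ac' u.1 v.1) u a' q.2 hg0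
        -- distances from the sites within one unit of `a'` to the source
        have hxa := hmI_gt a'
        rw [hma] at hxa
        have hfar : ∀ a'' : ↥(Box d ℓ k Ms), supNorm (a'.1 - a''.1) ≤ (((ℓ + 1) ^ k : ℕ) : ℝ) →
            ∀ x', P x' → ∃ μ, Rm m ≤ |posR ℓ k Ms a'' μ - posR ℓ k Ms x' μ| := by
          intro a'' ha'' x' hx'
          refine exists_coord_of_le_supNorm ℓ k Ms a'' x' (max3_mul_le hnr.le ?_ ?_ (supNorm_nonneg _))
          · have t1 := supNorm_sub_le_sub_add_sub x.1 a'.1 x'.1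
            have t2 := supNorm_sub_le_sub_add_sub a'.1 a''.1 x'.1
            have := hDx x' hx'
            have e1' : ((m : ℝ) + 1) * (((ℓ + 1) ^ k : ℕ) : ℝ) = (m : ℝ) * (((ℓ + 1) ^ k : ℕ) : ℝ)
                + (((ℓ + 1) ^ k : ℕ) : ℝ) := by ring
            rw [e1'] at hxa
            rw [show (D - (m : ℝ) - 2) * (((ℓ + 1) ^ k : ℕ) : ℝ) = D * (((ℓ + 1) ^ k : ℕ) : ℝ)
                - (m : ℝ) * (((ℓ + 1) ^ k : ℕ) : ℝ) - 2 * (((ℓ + 1) ^ k : ℕ) : ℝ) by ring]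
            linarith only [t1, t2, this, hxa, ha'']
          · have t1 := supNorm_sub_le_sub_add_sub (subEmb ℓ k Mb Ms o ho x').1 (subEmb ℓ k Mb Ms o ho a'').1 y.1
            have t2 := supNorm_sub_le_sub_add_sub (subEmb ℓ k Mb Ms o ho a'').1 (subEmb ℓ k Mb Ms o ho a').1 y.1
            rw [supNorm_subEmb_sub_subEmb] at t1 t2
            rw [supNorm_sub_comm x'.1] at t1
            rw [supNorm_sub_comm a''.1] at t2
            have := hDfx x' hx' y hy
            rw [sub_mul]
            linarith only [t1, t2, this, hdy, ha'']
        have hu' : ∀ a'' : ↥(Box d ℓ k Ms), supNorm (a'.1 - a''.1) ≤ (((ℓ + 1) ^ k : ℕ) : ℝ) → ∀ j,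
            |u (a'', j)| ≤ cv * Real.exp (-(Rm m / K)) * φ := by
          intro a'' ha'' j
          have := VΩ a'' P (Rm m) (hfar a'' ha'') f hfP φ hφ hf j
          exact this.trans (mul_le_mul_of_nonneg_right
            (mul_le_mul_of_nonneg_left (hmonoV (hRm0 m)) hcv.le) hφ)
        have hDu' : ∀ a'' : ↥(Box d ℓ k Ms), supNorm (a'.1 - a''.1) ≤ (((ℓ + 1) ^ k : ℕ) : ℝ) → ∀ μ,
            a''.1 + e1 μ ∈ Box d ℓ k Ms → ∀ j,
            |(derivA d F (e / ((ℓ + 1) ^ k : ℕ)) ℓ k Ms (fun u v : ↥(Box d ℓ k Ms) => compField Ac' u.1 v.1) μ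
                *ᵥ u) (a'', j)| ≤ cd * Real.exp (-(Rm m / K)) * φ := by
          intro a'' ha'' μ hμ j
          have := DΩ μ a'' hμ P (Rm m) (hfar a'' ha'') f hfP φ hφ hf j
          exact this.trans (mul_le_mul_of_nonneg_right
            (mul_le_mul_of_nonneg_left (hmonoD (hRm0 m)) hcd.le) hφ)
        have hkey := kOp_chi_apply_le ℓ k Mb Ms o F (e / ((ℓ + 1) ^ k : ℕ)) hℓ hk hn hMs ha ha1 ha2 m2 Ac' u a'
          (by positivity) (by positivity) hu' hDu' q.2
        refine hkey.trans ?_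
        have hE0 : 0 ≤ Real.exp (-(Rm m / K)) * φ := by positivity
        have : N2 * (16 * ((d : ℝ) + 1) * (cd * Real.exp (-(Rm m / K)) * φ)
            + (64 * ((d : ℝ) + 1) + 2 * aplus) * (cv * Real.exp (-(Rm m / K)) * φ))
            = CK * (Real.exp (-(Rm m / K)) * φ) := by simp only [hCK]; ring
        rw [this]
        show CK * (Real.exp (-(Rm m / K)) * φ) ≤ |CK| * Real.exp (-(Rm m / K)) * φ
        calc CK * (Real.exp (-(Rm m / K)) * φ) ≤ |CK| * (Real.exp (-(Rm m / K)) * φ) :=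
              mul_le_mul_of_nonneg_right (le_abs_self CK) hE0
          _ = |CK| * Real.exp (-(Rm m / K)) * φ := by ring
      · -- support: within `m + 3` units of `Ω₀ ∖ Ω`
        intro hsmall
        by_contra hg0
        obtain ⟨y, hy, hdy⟩ := exists_out_of_kOp_ne_zero ℓ k Mb Ms o F (e / ((ℓ + 1) ^ k : ℕ)) ho hn hn2 hMs
          (B1.aSeq a ((ℓ : ℝ) + 1) k) m2 (fun u v : ↥(Box d ℓ k Ms) => compField Ac' u.1 v.1) u a' q.2 hg0
        have t1 := supNorm_sub_le_sub_add_sub (subEmb ℓ k Mb Ms o ho x).1 (subEmb ℓ k Mb Ms o ho a').1 y.1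
        rw [supNorm_subEmb_sub_subEmb] at t1
        have h1 := hDbx y hy
        have h2 := hmI_gt a'
        rw [hma] at h2
        have h3 := mul_le_mul_of_nonneg_right hsmall hnr.le
        have e1' : ((m : ℝ) + 1) * (((ℓ + 1) ^ k : ℕ) : ℝ) = (m : ℝ) * (((ℓ + 1) ^ k : ℕ) : ℝ)
            + (((ℓ + 1) ^ k : ℕ) : ℝ) := by ring
        have e2' : ((m : ℝ) + 3) * (((ℓ + 1) ^ k : ℕ) : ℝ) = (m : ℝ) * (((ℓ + 1) ^ k : ℕ) : ℝ)
            + 3 * (((ℓ + 1) ^ k : ℕ) : ℝ) := by ring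
        rw [e1'] at h2
        rw [e2'] at h3
        linarith only [t1, h1, h2, h3, hdy]
    -- (ii) the row form of (1.10) on `Ω₀`, per annulus
    set bm : ℕ → ℝ := fun m => if (m : ℝ) + 3 ≤ Db then 0 else cv * Real.exp (-((m : ℝ) / K)) * Φm m with hbm
    have hterm : ∀ m, |(G₀ *ᵥ extV ℓ k Mb Ms o (gm m)) (subEmb ℓ k Mb Ms o ho x, i)| ≤ bm m := by
      intro m
      simp only [hbm]
      by_cases hsmall : (m : ℝ) + 3 ≤ Db
      · rw [if_pos hsmall]
        have h0 : extV ℓ k Mb Ms o (gm m) = 0 := funext fun q => (hsrc m q).2.1 hsmall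
        rw [h0, Matrix.mulVec_zero, Pi.zero_apply, abs_zero]
      rw [if_neg hsmall]
      set Pm : ↥(Box d ℓ k Mb) → Prop := fun y => ∃ a', subEmb ℓ k Mb Ms o ho a' = y ∧ mI a' = m with hPm
      haveI hPmd : DecidablePred Pm := Classical.decPred Pm
      have hDm : ∀ y, Pm y → ∃ μ, (m : ℝ) ≤ |posR ℓ k Mb (subEmb ℓ k Mb Ms o ho x) μ - posR ℓ k Mb y μ| := by
        rintro y ⟨a', rfl, hma⟩
        refine exists_coord_of_le_supNorm ℓ k Mb _ _ ?_
        rw [supNorm_subEmb_sub_subEmb, ← hma]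
        exact hmI_le a'
      have hsupp : ∀ q : ↥(Box d ℓ k Mb) × ι, ¬ Pm q.1 → extV ℓ k Mb Ms o (gm m) q = 0 := by
        intro q hq
        by_contra h0
        exact hq ((hsrc m q).2.2 h0)
      have h3 := VΩ₀ (subEmb ℓ k Mb Ms o ho x) Pm (m : ℝ) hDm (extV ℓ k Mb Ms o (gm m)) hsupp (Φm m) (hΦm0 m)
        (fun q => (hsrc m q).1) i
      exact h3.trans (mul_le_mul_of_nonneg_right
        (mul_le_mul_of_nonneg_left (hmonoV (Nat.cast_nonneg m)) hcv.le) (hΦm0 m))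
    -- (iii) the geometric series in the annulus index
    set m₀ : ℕ := ⌈Db - 3⌉₊ with hm₀
    have hbm_le : ∀ m, bm m ≤ cv * |CK| * φ * Real.exp (-((D + Df - 5) / (2 * K)))
        * (if m₀ ≤ m then r ^ m else 0) := by
      intro m
      simp only [hbm]
      by_cases hsmall : (m : ℝ) + 3 ≤ Db
      · rw [if_pos hsmall]
        split_ifs <;> positivity
      rw [if_neg hsmall]
      have hm0m : m₀ ≤ m := by
        rw [hm₀]
        exact Nat.ceil_le.mpr (by push Not at hsmall; linarith only [hsmall])
      rw [if_pos hm0m]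
      have hrm : r ^ m = Real.exp (-((m : ℝ) / (2 * K))) := by
        rw [hr, ← Real.exp_nat_mul]; congr 1; ring
      rw [hrm]
      have hexp : Real.exp (-((m : ℝ) / K)) * Real.exp (-(Rm m / K))
          ≤ Real.exp (-((D + Df - 5) / (2 * K))) * Real.exp (-((m : ℝ) / (2 * K))) := by
        rw [← Real.exp_add, ← Real.exp_add, Real.exp_le_exp]
        have hR : ((D - m - 2) + (Df - 3)) / 2 ≤ Rm m := by
          have h1 : D - m - 2 ≤ Rm m := (le_max_left _ _).trans (le_max_left _ _)
          have h2 : Df - 3 ≤ Rm m := (le_max_right _ _).trans (le_max_left _ _)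
          linarith only [h1, h2]
        rw [show -((m : ℝ) / K) + -(Rm m / K) = (-(m + Rm m)) / K by ring,
          show -((D + Df - 5) / (2 * K)) + -((m : ℝ) / (2 * K)) = (-((D + Df - 5) / 2 + m / 2)) / K by
            field_simp; ring]
        exact div_le_div_of_nonneg_right (by linarith only [hR]) hKr.le
      calc cv * Real.exp (-((m : ℝ) / K)) * (|CK| * Real.exp (-(Rm m / K)) * φ)
          = cv * |CK| * φ * (Real.exp (-((m : ℝ) / K)) * Real.exp (-(Rm m / K))) := by ring
        _ ≤ cv * |CK| * φ * (Real.exp (-((D + Df - 5) / (2 * K))) * Real.exp (-((m : ℝ) / (2 * K)))) :=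
            mul_le_mul_of_nonneg_left hexp (by positivity)
        _ = cv * |CK| * φ * Real.exp (-((D + Df - 5) / (2 * K))) * Real.exp (-((m : ℝ) / (2 * K))) := by ring
    have hgeom : ∑ m ∈ Finset.range Mtop, (if m₀ ≤ m then r ^ m else 0) ≤ r ^ m₀ / (1 - r) := by
      rw [← Finset.sum_filter]
      have hsub : (Finset.range Mtop).filter (fun m => m₀ ≤ m) ⊆ Finset.Ico m₀ Mtop := by
        intro m hm
        rw [Finset.mem_filter, Finset.mem_range] at hm
        exact Finset.mem_Ico.mpr ⟨hm.2, hm.1⟩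
      refine (Finset.sum_le_sum_of_subset_of_nonneg hsub fun m _ _ => pow_nonneg hr0 m).trans ?_
      exact geom_sum_Ico_le_of_lt_one hr0 hr1
    have hrm₀ : r ^ m₀ ≤ Real.exp (-((Db - 3) / (2 * K))) := by
      rw [hr, ← Real.exp_nat_mul, Real.exp_le_exp]
      have : Db - 3 ≤ (m₀ : ℝ) := Nat.le_ceil _
      rw [show ((m₀ : ℕ) : ℝ) * -(1 / (2 * (K : ℝ))) = (-(m₀ : ℝ)) / (2 * K) by ring,
        show -((Db - 3) / (2 * (K : ℝ))) = (-(Db - 3)) / (2 * K) by ring]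
      exact div_le_div_of_nonneg_right (by linarith only [this]) (by positivity)
    -- assemble T2
    rw [hsplit, Matrix.mulVec_sum, Finset.sum_apply]
    refine (Finset.abs_sum_le_sum_abs _ _).trans ?_
    calc ∑ m ∈ Finset.range Mtop, |(G₀ *ᵥ extV ℓ k Mb Ms o (gm m)) (subEmb ℓ k Mb Ms o ho x, i)|
        ≤ ∑ m ∈ Finset.range Mtop, cv * |CK| * φ * Real.exp (-((D + Df - 5) / (2 * K)))
            * (if m₀ ≤ m then r ^ m else 0) :=
          Finset.sum_le_sum fun m _ => (hterm m).trans (hbm_le m)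
      _ = cv * |CK| * φ * Real.exp (-((D + Df - 5) / (2 * K)))
            * ∑ m ∈ Finset.range Mtop, (if m₀ ≤ m then r ^ m else 0) := by rw [Finset.mul_sum]
      _ ≤ cv * |CK| * φ * Real.exp (-((D + Df - 5) / (2 * K))) * (Real.exp (-((Db - 3) / (2 * K))) / (1 - r)) := by
          refine mul_le_mul_of_nonneg_left (hgeom.trans ?_) (by positivity)
          exact div_le_div_of_nonneg_right hrm₀ h1r.le
      _ = cv * |CK| * Real.exp (4 / K) / (1 - r) * FF * φ := by
          have : Real.exp (-((D + Df - 5) / (2 * K))) * Real.exp (-((Db - 3) / (2 * K)))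
              = Real.exp (4 / K) * FF := by
            rw [hFF, ← Real.exp_add, ← Real.exp_add]; congr 1; field_simp; ring
          calc cv * |CK| * φ * Real.exp (-((D + Df - 5) / (2 * K))) * (Real.exp (-((Db - 3) / (2 * K))) / (1 - r))
              = cv * |CK| * φ * (Real.exp (-((D + Df - 5) / (2 * K))) * Real.exp (-((Db - 3) / (2 * K))))
                  / (1 - r) := by ring
            _ = cv * |CK| * Real.exp (4 / K) / (1 - r) * FF * φ := by rw [this]; ring
  ---------------------------------------------------------------- total
  have hsum : |(1 - χv x) * u (x, i) - (G₀ *ᵥ extV ℓ k Mb Ms o g) (subEmb ℓ k Mb Ms o ho x, i)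
      - (G₀ *ᵥ extV ℓ k Mb Ms o (mulH (ι := ι) (fun z => 1 - χv z) *ᵥ f)) (subEmb ℓ k Mb Ms o ho x, i)|
      ≤ cv * Real.exp (1 / K) * FF * φ + cv * |CK| * Real.exp (4 / K) / (1 - r) * FF * φ
        + cv * Real.exp (1 / K) * FF * φ := by
    refine (abs_sub _ _).trans (add_le_add ((abs_sub _ _).trans (add_le_add hT1 hT2)) hT3)
  refine hsum.trans ?_
  have : cv * Real.exp (1 / K) * FF * φ + cv * |CK| * Real.exp (4 / K) / (1 - r) * FF * φ
      + cv * Real.exp (1 / K) * FF * φ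
      = (2 * cv * Real.exp (1 / K) + cv * |CK| * Real.exp (4 / K) / (1 - r)) * FF * φ := by ring
  rw [this, hFF]
  refine mul_le_mul_of_nonneg_right (mul_le_mul_of_nonneg_right ?_ hFF0.le) hφ
  rw [hc₀]
  exact le_add_of_nonneg_right zero_le_one

end Main

end

end Literature.MathematicalPhysics.QuantumFieldTheory.Balaban1983to89.B4Thm112BoxValue
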